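import Mathlib
import Literature.NumberTheory.LFunctions.MertensTail
import HarnessLib

/-!
# `LiouvilleOrthogonalTC0` (stmt-QuantumAdvantage-1393), line `Sketch` — stub `stub_levels`

**The levels of the transfer.** For `k ≥ 1`, `κ > 0`, `Λ₀ ≥ 1`, `L₀ ≥ 1` there are a constant
`A ≥ 2` and prime thresholds `z n 0 ≤ z n 1 ≤ ⋯ ≤ z n k` (`n : ℕ`) such that, eventually in `n`:
the top level is `≥ 2ⁿ`, every lower level is `≥ 2^(n/A)`, consecutive windows are wide
(`(z n i)^Λ₀ ≤ z n (i+1)`) and heavy (the primes of `(⌈2 (z n i)^(2+κ)⌉, min (z n (i+1)) 2^(n/3)]`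
have `∑ 1/p ≥ L₀`).

Construction: a tower. With the ratio `Λ := max (Λ₀ + 1) ((3+κ) e^(L₀+2))` and
`a₀ := 1 / (3 Λ^k)`, put `z n j := ⌊2^(n Λ^j a₀)⌋₊` for `j < k` and `z n k := 2ⁿ`
(`= ⌊2^(n · 1)⌋₊`), and `A := max 2 ⌈2/a₀⌉₊`.  The exponent of the level above `z n i`
(`i < k`) is `≥ Λ · Λ^i a₀` and `Λ^(i+1) a₀ ≤ Λ^k a₀ = 1/3`; the four window properties are then
elementary real inequalities about `⌊2^w⌋₊` (`StubLevels.window`), the heavy one being Mertens'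
second theorem in tail form (the tree's PROVED
`Literature.NumberTheory.LFunctions.MertensBound.loglog_sub_loglog_le_sum_inv_prime`, packaged as
`StubLevels.mertens_window`, the pointwise form of the sibling `stub_levelsA`) applied with
`a := Λ^i a₀ ≥ a₀`: `log (Λ/(3+κ)) - 1 ≥ L₀ + 1`.  (Self-contained: the file does not import the
sibling module `…StubLevelsA`, only `Literature.NumberTheory.LFunctions.MertensTail`.)

Theorem-only file, proved from the tree; no named facts are used.
-/

set_option linter.dupNamespace false -- D-0017: single-problem summit ⇒ `QuantumAdvantage.QuantumAdvantage` by design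

noncomputable section

namespace Summit.QuantumAdvantage.QuantumAdvantage.Theorems.LiouvilleOrthogonalTC0

open Filter Finset

namespace StubLevels

/-- **A heavy window (Mertens, pointwise form of `stub_levelsA`).** For `Λ ≥ 3 + κ`, `n a₀ ≥ 3` and
an exponent `a ≥ a₀`, every prime window `(P, Q]` with `e⁶ ≤ P ≤ 2^(n a (2+κ) + 2)` and
`Q ≥ 2^(n Λ a - 1)` has `∑ 1/p ≥ log (Λ/(3+κ)) - 1`: by the tree's
`loglog_sub_loglog_le_sum_inv_prime`, `log Q / log P ≥ (n Λ a - 1)/(n a (2+κ) + 2) ≥ Λ/(3+κ)` and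
`6 / log P ≤ 1`. [folklore] -/
theorem mertens_window {κ Λ a₀ a : ℝ} {n P Q : ℕ} (hκ : 0 < κ) (hΛ : 3 + κ ≤ Λ)
    (hn : 3 ≤ (n : ℝ) * a₀) (ha : a₀ ≤ a) (hP : Real.exp 6 ≤ (P : ℝ))
    (hPle : (P : ℝ) ≤ (2 : ℝ) ^ ((n : ℝ) * a * (2 + κ) + 2))
    (hQ : (2 : ℝ) ^ ((n : ℝ) * Λ * a - 1) ≤ (Q : ℝ)) :
    Real.log (Λ / (3 + κ)) - 1 ≤ ∑ p ∈ (Finset.Ioc P Q).filter Nat.Prime, (1 : ℝ) / p := by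
  have hx : 3 ≤ (n : ℝ) * a := by
    have := mul_le_mul_of_nonneg_left ha (Nat.cast_nonneg n)
    linarith
  have h3κ : (0 : ℝ) < 3 + κ := by linarith
  have hΛ0 : 0 < Λ := by linarith
  have hlog2 : 0 < Real.log 2 := Real.log_pos one_lt_two
  -- `P ≥ 2`, `log P ≥ 6`
  have hP0 : (0 : ℝ) < P := (Real.exp_pos 6).trans_le hP
  have hlogP : 6 ≤ Real.log P := by
    have := Real.log_le_log (Real.exp_pos 6) hP
    rwa [Real.log_exp] at this
  have hP2 : (2 : ℝ) ≤ P := by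
    have := Real.add_one_le_exp (6 : ℝ)
    linarith
  -- `log P ≤ (n a (2+κ) + 2) log 2`
  have hlogP' : Real.log P ≤ ((n : ℝ) * a * (2 + κ) + 2) * Real.log 2 := by
    have := Real.log_le_log hP0 hPle
    rwa [Real.log_rpow two_pos] at this
  -- the exponents compare: `n a (2+κ) + 2 ≤ n Λ a - 1`, so `P ≤ Q`
  have hexp : (n : ℝ) * a * (2 + κ) + 2 ≤ (n : ℝ) * Λ * a - 1 := by
    nlinarith [mul_nonneg (sub_nonneg.2 hx) (sub_nonneg.2 hΛ)]
  have hPQ : (P : ℝ) ≤ Q :=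
    hPle.trans ((Real.rpow_le_rpow_of_exponent_le one_le_two hexp).trans hQ)
  -- `log Q ≥ (n Λ a - 1) log 2`
  have hlogQ : ((n : ℝ) * Λ * a - 1) * Real.log 2 ≤ Real.log Q := by
    have := Real.log_le_log (by positivity) hQ
    rwa [Real.log_rpow two_pos] at this
  -- Mertens
  have hM := Literature.NumberTheory.LFunctions.MertensBound.loglog_sub_loglog_le_sum_inv_prime
    hP2 hPQ
  rw [Nat.floor_natCast, Nat.floor_natCast] at hM
  have h6 : 6 / Real.log P ≤ 1 := (div_le_one (by linarith)).mpr hlogP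
  have hlogP0 : 0 < Real.log P := by linarith
  -- `(Λ / (3+κ)) log P ≤ log Q`
  have hkey : Λ / (3 + κ) * Real.log P ≤ Real.log Q := by
    have h1 : Λ / (3 + κ) * Real.log P ≤
        Λ / (3 + κ) * (((n : ℝ) * a * (2 + κ) + 2) * Real.log 2) :=
      mul_le_mul_of_nonneg_left hlogP' (by positivity)
    have h2 : Λ / (3 + κ) * (((n : ℝ) * a * (2 + κ) + 2) * Real.log 2) ≤
        ((n : ℝ) * Λ * a - 1) * Real.log 2 := by
      rw [div_mul_eq_mul_div, div_le_iff₀ h3κ]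
      have : Λ * ((n : ℝ) * a * (2 + κ) + 2) ≤ ((n : ℝ) * Λ * a - 1) * (3 + κ) := by
        nlinarith [mul_nonneg (sub_nonneg.2 hx) hΛ0.le]
      nlinarith [mul_le_mul_of_nonneg_right this hlog2.le]
    linarith
  have hlog : Real.log (Λ / (3 + κ)) + Real.log (Real.log P) ≤ Real.log (Real.log Q) := by
    rw [← Real.log_mul (by positivity) hlogP0.ne']
    exact Real.log_le_log (by positivity) hkey
  linarith

/-- `2^(w-1) ≤ ⌊2^w⌋₊` for `w ≥ 1` (as `2^w ≥ 2`). [folklore] -/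
theorem rpow_sub_one_le_floor {w : ℝ} (hw : 1 ≤ w) :
    (2 : ℝ) ^ (w - 1) ≤ ((⌊(2 : ℝ) ^ w⌋₊ : ℕ) : ℝ) := by
  have h2w : (2 : ℝ) ≤ 2 ^ w := by
    calc (2 : ℝ) = 2 ^ (1 : ℝ) := (Real.rpow_one 2).symm
      _ ≤ 2 ^ w := Real.rpow_le_rpow_of_exponent_le one_le_two hw
  have hfl := Nat.sub_one_lt_floor ((2 : ℝ) ^ w)
  rw [Real.rpow_sub two_pos, Real.rpow_one]
  linarith

/-- The levels are monotone in the exponent. [folklore] -/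
theorem floor_mono {s t : ℝ} (h : s ≤ t) : ⌊(2 : ℝ) ^ s⌋₊ ≤ ⌊(2 : ℝ) ^ t⌋₊ :=
  Nat.floor_le_floor (Real.rpow_le_rpow_of_exponent_le one_le_two h)

/-- The top level: `⌊2^n⌋₊ = 2^n`. [folklore] -/
theorem floor_two_pow (n : ℕ) : ⌊(2 : ℝ) ^ n⌋₊ = 2 ^ n := by
  rw [← Nat.cast_two (R := ℝ), ← Nat.cast_pow, Nat.floor_natCast]

/-- Lower levels are not too small: `2^v ≤ ⌊2^w⌋₊` once `2 ≤ w` and `v ≤ w/2`. [folklore] -/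
theorem rpow_le_floor {v w : ℝ} (hw : 2 ≤ w) (hv : v ≤ w / 2) :
    (2 : ℝ) ^ v ≤ ((⌊(2 : ℝ) ^ w⌋₊ : ℕ) : ℝ) :=
  (Real.rpow_le_rpow_of_exponent_le one_le_two (by linarith : v ≤ w - 1)).trans
    (rpow_sub_one_le_floor (by linarith))

/-- Wide windows: `(⌊2^w⌋₊)^Λ₀ ≤ ⌊2^w'⌋₊` once `0 ≤ Λ₀`, `w Λ₀ ≤ w' - 1`, `1 ≤ w'`. [folklore] -/
theorem floor_rpow_le_floor {w w' Λ₀ : ℝ} (hΛ₀ : 0 ≤ Λ₀) (h : w * Λ₀ ≤ w' - 1) (hw' : 1 ≤ w') :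
    (((⌊(2 : ℝ) ^ w⌋₊ : ℕ) : ℝ)) ^ Λ₀ ≤ ((⌊(2 : ℝ) ^ w'⌋₊ : ℕ) : ℝ) := by
  calc (((⌊(2 : ℝ) ^ w⌋₊ : ℕ) : ℝ)) ^ Λ₀ ≤ ((2 : ℝ) ^ w) ^ Λ₀ :=
        Real.rpow_le_rpow (Nat.cast_nonneg _) (Nat.floor_le (by positivity)) hΛ₀
    _ = 2 ^ (w * Λ₀) := (Real.rpow_mul zero_le_two w Λ₀).symm
    _ ≤ 2 ^ (w' - 1) := Real.rpow_le_rpow_of_exponent_le one_le_two h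
    _ ≤ _ := rpow_sub_one_le_floor hw'

/-- `e⁶ ≤ 512`. [folklore] -/
theorem exp_six_le : Real.exp 6 ≤ 512 := by
  have h6 : Real.exp 6 = Real.exp 1 ^ 6 := by rw [Real.exp_one_pow]; norm_num
  rw [h6]
  calc Real.exp 1 ^ 6 ≤ 2.7182818286 ^ 6 :=
        pow_le_pow_left₀ (Real.exp_pos 1).le Real.exp_one_lt_d9.le 6
    _ ≤ 512 := by norm_num

/-- The left end of a window: `P = ⌈2 ⌊2^t⌋₊^(2+κ)⌉₊` satisfies `e⁶ ≤ P ≤ 2^(t (2+κ) + 2)`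
once `t ≥ 9` (`κ ≥ 0`). [folklore] -/
theorem window_left {κ t : ℝ} (hκ : 0 ≤ κ) (ht : 9 ≤ t) :
    Real.exp 6 ≤ ((⌈2 * ((⌊(2 : ℝ) ^ t⌋₊ : ℕ) : ℝ) ^ (2 + κ)⌉₊ : ℕ) : ℝ) ∧
    ((⌈2 * ((⌊(2 : ℝ) ^ t⌋₊ : ℕ) : ℝ) ^ (2 + κ)⌉₊ : ℕ) : ℝ) ≤ (2 : ℝ) ^ (t * (2 + κ) + 2) := by
  have hy1 : (2 : ℝ) ^ (t - 1) ≤ ((⌊(2 : ℝ) ^ t⌋₊ : ℕ) : ℝ) := rpow_sub_one_le_floor (by linarith)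
  have hyt : ((⌊(2 : ℝ) ^ t⌋₊ : ℕ) : ℝ) ≤ 2 ^ t := Nat.floor_le (by positivity)
  have h256 : (256 : ℝ) ≤ 2 ^ (t - 1) := by
    calc (256 : ℝ) = 2 ^ ((8 : ℕ) : ℝ) := by rw [Real.rpow_natCast]; norm_num
      _ ≤ 2 ^ (t - 1) := Real.rpow_le_rpow_of_exponent_le one_le_two (by norm_num; linarith)
  generalize ((⌊(2 : ℝ) ^ t⌋₊ : ℕ) : ℝ) = y at hy1 hyt ⊢
  have hy : (256 : ℝ) ≤ y := h256.trans hy1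
  have hyle : y ≤ y ^ (2 + κ) := Real.self_le_rpow_of_one_le (by linarith) (by linarith)
  constructor
  · calc Real.exp 6 ≤ 512 := exp_six_le
      _ ≤ 2 * y ^ (2 + κ) := by linarith
      _ ≤ _ := Nat.le_ceil _
  · have h1 : ((⌈2 * y ^ (2 + κ)⌉₊ : ℕ) : ℝ) < 2 * y ^ (2 + κ) + 1 :=
      Nat.ceil_lt_add_one (by positivity)
    have h2 : y ^ (2 + κ) ≤ (2 ^ t) ^ (2 + κ) := Real.rpow_le_rpow (by linarith) hyt (by linarith)
    have h3 : ((2 : ℝ) ^ t) ^ (2 + κ) = 2 ^ (t * (2 + κ)) := (Real.rpow_mul zero_le_two _ _).symm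
    have h4 : (2 : ℝ) ^ (t * (2 + κ) + 2) = 2 ^ (t * (2 + κ)) * 4 := by
      rw [Real.rpow_add two_pos]; norm_num
    have h5 : (1 : ℝ) ≤ 2 ^ (t * (2 + κ)) := Real.one_le_rpow one_le_two (by positivity)
    rw [h4]
    linarith

/-- The right end of a window: `2^(u-1) ≤ min ⌊2^s⌋₊ ⌊2^t⌋₊` once `1 ≤ u ≤ s, t`. [folklore] -/
theorem window_right {u s t : ℝ} (hu : 1 ≤ u) (hus : u ≤ s) (hut : u ≤ t) :
    (2 : ℝ) ^ (u - 1) ≤ ((min ⌊(2 : ℝ) ^ s⌋₊ ⌊(2 : ℝ) ^ t⌋₊ : ℕ) : ℝ) := by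
  rw [Nat.cast_min]
  exact le_min ((rpow_sub_one_le_floor hu).trans (by exact_mod_cast floor_mono hus))
    ((rpow_sub_one_le_floor hu).trans (by exact_mod_cast floor_mono hut))

/-- **One window, all four level properties.** For the lower level `⌊2^(n a)⌋₊` and the upper
level `⌊2^(n a')⌋₊` with `a₀ ≤ a`, `Λ a ≤ a'`, `Λ a ≤ 1/3`, `n a₀ ≥ 9`, `A ≥ 2/a₀`,
`Λ ≥ Λ₀ + 1` and the Mertens conclusion of `mertens_window` at `n`: the window is monotone, its
lower level is `≥ 2^(n/A)`, it is wide and it is heavy. [folklore] -/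
theorem window {n A : ℕ} {κ Λ Λ₀ L₀ a₀ a a' : ℝ}
    (hA : ∀ a : ℝ, a₀ ≤ a → ∀ P Q : ℕ, Real.exp 6 ≤ (P : ℝ) →
      (P : ℝ) ≤ (2 : ℝ) ^ ((n : ℝ) * a * (2 + κ) + 2) → (2 : ℝ) ^ ((n : ℝ) * Λ * a - 1) ≤ (Q : ℝ) →
      Real.log (Λ / (3 + κ)) - 1 ≤ ∑ p ∈ (Finset.Ioc P Q).filter Nat.Prime, (1 : ℝ) / p)
    (hκ : 0 ≤ κ) (hΛ₀ : 0 ≤ Λ₀) (hΛ : Λ₀ + 1 ≤ Λ) (hL : L₀ ≤ Real.log (Λ / (3 + κ)) - 1)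
    (ha₀ : 0 < a₀) (ha : a₀ ≤ a) (haa' : Λ * a ≤ a') (ha3 : Λ * a ≤ 1 / 3)
    (hn : 9 ≤ (n : ℝ) * a₀) (hAa : 2 / a₀ ≤ (A : ℝ)) :
    ⌊(2 : ℝ) ^ ((n : ℝ) * a)⌋₊ ≤ ⌊(2 : ℝ) ^ ((n : ℝ) * a')⌋₊ ∧
    (2 : ℝ) ^ ((n : ℝ) / (A : ℝ)) ≤ ((⌊(2 : ℝ) ^ ((n : ℝ) * a)⌋₊ : ℕ) : ℝ) ∧
    (((⌊(2 : ℝ) ^ ((n : ℝ) * a)⌋₊ : ℕ) : ℝ)) ^ Λ₀ ≤ ((⌊(2 : ℝ) ^ ((n : ℝ) * a')⌋₊ : ℕ) : ℝ) ∧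
    L₀ ≤ ∑ p ∈ (Finset.Ioc ⌈2 * ((⌊(2 : ℝ) ^ ((n : ℝ) * a)⌋₊ : ℕ) : ℝ) ^ (2 + κ)⌉₊
      (min ⌊(2 : ℝ) ^ ((n : ℝ) * a')⌋₊ ⌊(2 : ℝ) ^ ((n : ℝ) / 3)⌋₊)).filter Nat.Prime, (1 : ℝ) / p := by
  have hn0 : (0 : ℝ) ≤ n := Nat.cast_nonneg n
  have hna : 9 ≤ (n : ℝ) * a := hn.trans (mul_le_mul_of_nonneg_left ha hn0)
  have hΛ1 : 1 ≤ Λ := by linarith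
  have ha0 : 0 < a := ha₀.trans_le ha
  have hna' : (n : ℝ) * (Λ * a) ≤ (n : ℝ) * a' := mul_le_mul_of_nonneg_left haa' hn0
  have hnaΛ : (n : ℝ) * a * 1 ≤ (n : ℝ) * a * Λ := mul_le_mul_of_nonneg_left hΛ1 (by positivity)
  refine ⟨floor_mono ?_, rpow_le_floor (by linarith) ?_, floor_rpow_le_floor hΛ₀ ?_ ?_, ?_⟩
  · nlinarith
  · have hA0 : (0 : ℝ) < A := lt_of_lt_of_le (by positivity) hAa
    have h2 : 2 ≤ (A : ℝ) * a₀ := (div_le_iff₀ ha₀).1 hAa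
    have h3 : (A : ℝ) * a₀ ≤ A * a := mul_le_mul_of_nonneg_left ha hA0.le
    rw [div_le_iff₀ hA0]
    nlinarith [mul_le_mul_of_nonneg_left (h2.trans h3) hn0]
  · have : (n : ℝ) * a * (Λ₀ + 1) ≤ (n : ℝ) * a * Λ := mul_le_mul_of_nonneg_left hΛ (by positivity)
    nlinarith
  · nlinarith
  · -- heavy: Mertens via `mertens_window`
    obtain ⟨hP1, hP2⟩ := window_left hκ hna
    have hn3 : (n : ℝ) * (Λ * a) ≤ (n : ℝ) * (1 / 3) := mul_le_mul_of_nonneg_left ha3 hn0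
    have hQ := window_right (u := (n : ℝ) * Λ * a) (s := (n : ℝ) * a') (t := (n : ℝ) / 3)
      (by nlinarith) (by nlinarith) (by nlinarith)
    have hS := hA a ha _ _ hP1 hP2 hQ
    linarith

end StubLevels

set_option linter.unusedVariables false in -- registered stub signature (skeleton stmt-QuantumAdvantage-1393); hypothesis kept
/-- **Stub (levels).** For `k ≥ 1`, `κ > 0`, `Λ₀ ≥ 1`, `L₀ ≥ 1` there are `A ≥ 2` and levels
`z n : Fin (k+1) → ℕ` such that eventually in `n`: `z n` is monotone, `z n k ≥ 2ⁿ`, every lower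
level is `≥ 2^(n/A)`, consecutive windows are wide (`(z n i)^Λ₀ ≤ z n (i+1)`) and heavy (the
primes `p` of `(⌈2 (z n i)^(2+κ)⌉, min (z n (i+1)) ⌊2^(n/3)⌋]` have `∑ 1/p ≥ L₀`). Construction:
the tower `z n j = ⌊2^(n Λ^j a₀)⌋₊` (`j < k`), `z n k = 2ⁿ`, with `Λ = max (Λ₀+1) ((3+κ)e^(L₀+2))`,
`a₀ = 1/(3Λ^k)`, `A = max 2 ⌈2/a₀⌉₊`; heavy windows by Mertens (`mertens_window`). (The hypothesis
`1 ≤ k` is not needed: for `k = 0` there are no windows.) -/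
theorem stub_levels (k : ℕ) (hk : 1 ≤ k) (κ Λ₀ L₀ : ℝ) (hκ : 0 < κ) (hΛ₀ : 1 ≤ Λ₀) (hL₀ : 1 ≤ L₀) :
    ∃ A : ℕ, 2 ≤ A ∧ ∃ z : ℕ → Fin (k + 1) → ℕ, ∀ᶠ n : ℕ in atTop,
      Monotone (z n) ∧ 2 ^ n ≤ z n (Fin.last k) ∧
      (∀ i : Fin k, (2 : ℝ) ^ ((n : ℝ) / (A : ℝ)) ≤ z n i.castSucc) ∧
      (∀ i : Fin k, ((z n i.castSucc : ℕ) : ℝ) ^ Λ₀ ≤ z n i.succ) ∧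
      (∀ i : Fin k, L₀ ≤ ∑ p ∈ (Finset.Ioc ⌈2 * ((z n i.castSucc : ℕ) : ℝ) ^ (2 + κ)⌉₊
          (min (z n i.succ) ⌊(2 : ℝ) ^ ((n : ℝ) / 3)⌋₊)).filter Nat.Prime, (1 : ℝ) / p) := by
  -- the tower ratio `Λ`
  obtain ⟨Λ, hΛ₀Λ, hΛexp⟩ : ∃ Λ : ℝ, Λ₀ + 1 ≤ Λ ∧ (3 + κ) * Real.exp (L₀ + 2) ≤ Λ :=
    ⟨max (Λ₀ + 1) ((3 + κ) * Real.exp (L₀ + 2)), le_max_left _ _, le_max_right _ _⟩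
  have hΛ1 : 1 ≤ Λ := by linarith
  have h3κ : (0 : ℝ) < 3 + κ := by linarith
  have hΛκ : 3 + κ ≤ Λ := by
    have : (1 : ℝ) ≤ Real.exp (L₀ + 2) := Real.one_le_exp (by linarith)
    nlinarith
  have hL : L₀ ≤ Real.log (Λ / (3 + κ)) - 1 := by
    have h1 : Real.exp (L₀ + 2) ≤ Λ / (3 + κ) := by
      rw [le_div_iff₀ h3κ, mul_comm]; exact hΛexp
    have h2 := Real.log_le_log (Real.exp_pos _) h1
    rw [Real.log_exp] at h2
    linarith
  -- the smallest exponent `a₀ = Λ^(-k)/3`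
  obtain ⟨a₀, ha₀, hka₀⟩ : ∃ a₀ : ℝ, 0 < a₀ ∧ Λ ^ k * a₀ = 1 / 3 :=
    ⟨1 / (3 * Λ ^ k), by positivity, by field_simp⟩
  -- the constant `A`
  obtain ⟨A, hA2, hAa⟩ : ∃ A : ℕ, 2 ≤ A ∧ 2 / a₀ ≤ (A : ℝ) :=
    ⟨max 2 ⌈2 / a₀⌉₊, le_max_left _ _,
      (Nat.le_ceil _).trans (by exact_mod_cast le_max_right 2 ⌈2 / a₀⌉₊)⟩
  -- the levels
  obtain ⟨z, hzc, hzs, hzl⟩ : ∃ z : ℕ → Fin (k + 1) → ℕ,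
      (∀ n : ℕ, ∀ i : Fin k, z n i.castSucc = ⌊(2 : ℝ) ^ ((n : ℝ) * (Λ ^ (i : ℕ) * a₀))⌋₊) ∧
      (∀ n : ℕ, ∀ i : Fin k, z n i.succ =
        ⌊(2 : ℝ) ^ ((n : ℝ) * (if (i : ℕ) + 1 < k then Λ ^ ((i : ℕ) + 1) * a₀ else 1))⌋₊) ∧
      (∀ n : ℕ, z n (Fin.last k) = 2 ^ n) := by
    refine ⟨fun n j => ⌊(2 : ℝ) ^ ((n : ℝ) * (if (j : ℕ) < k then Λ ^ (j : ℕ) * a₀ else 1))⌋₊,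
      fun n i => by simp, fun n i => by simp [Fin.val_succ], fun n => ?_⟩
    simp only [Fin.val_last, lt_self_iff_false, if_false, mul_one, Real.rpow_natCast]
    exact StubLevels.floor_two_pow n
  refine ⟨A, hA2, z, ?_⟩
  filter_upwards [tendsto_natCast_atTop_atTop.eventually_ge_atTop (9 / a₀ : ℝ)] with n hn
  have hn9 : 9 ≤ (n : ℝ) * a₀ := by rw [div_le_iff₀ ha₀] at hn; linarith
  -- the heavy-window bound at this `n`, uniformly in the exponent `a ≥ a₀`
  have hA : ∀ a : ℝ, a₀ ≤ a → ∀ P Q : ℕ, Real.exp 6 ≤ (P : ℝ) →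
      (P : ℝ) ≤ (2 : ℝ) ^ ((n : ℝ) * a * (2 + κ) + 2) → (2 : ℝ) ^ ((n : ℝ) * Λ * a - 1) ≤ (Q : ℝ) →
      Real.log (Λ / (3 + κ)) - 1 ≤ ∑ p ∈ (Finset.Ioc P Q).filter Nat.Prime, (1 : ℝ) / p :=
    fun a ha P Q hP hPle hQ => StubLevels.mertens_window hκ hΛκ (by linarith) ha hP hPle hQ
  -- the exponents of consecutive levels
  have hb : ∀ i : Fin k, a₀ ≤ Λ ^ (i : ℕ) * a₀ ∧
      Λ * (Λ ^ (i : ℕ) * a₀) ≤ (if (i : ℕ) + 1 < k then Λ ^ ((i : ℕ) + 1) * a₀ else 1) ∧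
      Λ * (Λ ^ (i : ℕ) * a₀) ≤ 1 / 3 := by
    intro i
    have h1 : Λ * (Λ ^ (i : ℕ) * a₀) = Λ ^ ((i : ℕ) + 1) * a₀ := by ring
    have h2 : Λ ^ ((i : ℕ) + 1) * a₀ ≤ 1 / 3 := by
      rw [← hka₀]
      exact mul_le_mul_of_nonneg_right (pow_le_pow_right₀ hΛ1 i.2) ha₀.le
    refine ⟨le_mul_of_one_le_left ha₀.le (one_le_pow₀ hΛ1), ?_, h1 ▸ h2⟩
    split_ifs
    · exact h1.le
    · linarith
  have key := fun i : Fin k =>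
    StubLevels.window hA hκ.le (by linarith) hΛ₀Λ hL ha₀ (hb i).1 (hb i).2.1 (hb i).2.2 hn9 hAa
  refine ⟨Fin.monotone_iff_le_succ.2 fun i => ?_, (hzl n).ge, fun i => ?_, fun i => ?_,
    fun i => ?_⟩
  · rw [hzc n i, hzs n i]; exact (key i).1
  · rw [hzc n i]; exact (key i).2.1
  · rw [hzc n i, hzs n i]; exact (key i).2.2.1
  · rw [hzc n i, hzs n i]; exact (key i).2.2.2

end Summit.QuantumAdvantage.QuantumAdvantage.Theorems.LiouvilleOrthogonalTC0
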